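import Summits.CriticalPhenomena.PercolationContinuityZ3.Theorems.PercNearOneGluingNoHeavyLowerTailOrderedDifferences

/-!
# Ordered Marica–Schönheim with targets (the certificate form of the Möbius-rank method)

Helper file for crux `stmt-CriticalPhenomena-4575` (`NoHeavyLowerTail`, route `PercNearOneGluingNoHeavy`), seat `prim-l12-p6`
gen 33; memo `run/shared/lean/prim/prim-l12/FROM-prim-l12-p6-g33-C3I-RANK-PLUS.md`.  Pure finite set theory; everything PROVED.

`OrderedDifferences.card_le_card_of_rank` bounds the size of a ranked family `A` by the number of differences
`A i \ A j` (`r i ≤ r j`).  The rank argument works verbatim when the subtracted set is any **target** `B j ⊇ A j`: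

**Theorem (`card_le_card_of_rank_targets`).**  Let `A, B : ι → Finset α` with `A i ⊆ B i`, let `r` be a rank function
into a linear order with `A i ⊄ B j` whenever `i ≠ j` and `r i ≤ r j`, and let `T` contain every `A i \ B j` with
`r i ≤ r j`.  Then `card ι ≤ #T`.

Proof: with Möbius weights `μ` of `T` (`∑_{E ∈ T, E ⊆ Z} μ E = [Z = ∅]` for `Z ∈ T`), the matrices
`P i E = μ E · [E ⊆ A i]` and `Q E j = [E ∩ B j = ∅]` have `(P Q) i j = ∑_{E ∈ T, E ⊆ A i \ B j} μ E = [A i ⊆ B j]`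
for `r i ≤ r j`, so `P Q` is block-unitriangular and `rank P = card ι ≤ #T`.  Enlarging the targets trades the
non-containment condition (harder) against the membership condition (easier when `T` is closed under subsets,
`card_le_card_of_rank_targets_of_down` — then a column whose target's difference set lies in `T` needs no
membership check at all).  This is the lemma behind the certificates for the cyclic pairing inequality `C3I` of
the memo (§2: the two-class case is `card_add_card_le_card_diffs_union`; §4: the conjectured three-class
certificates use targets equal to the row or to a member of the up-set of goods).
-/

namespace Summit.CriticalPhenomena.PercolationContinuityZ3.Theorems

namespace OrderedDifferences

open Finset Matrix

variable {α : Type*} [DecidableEq α]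

/-- **Ordered Marica–Schönheim with targets.**  Let `A B : ι → Finset α` with `A i ⊆ B i` for all `i`, ranked by
`r` into a linear order so that `A i ⊄ B j` for all `i ≠ j` with `r i ≤ r j`, and let `T` contain every difference
`A i \ B j` with `r i ≤ r j`.  Then `card ι ≤ #T`.  (`B = A` is `card_le_card_of_rank`.) [this work] -/
theorem card_le_card_of_rank_targets {ι β : Type*} [Fintype ι] [DecidableEq ι] [LinearOrder β]
    (A B : ι → Finset α) (r : ι → β) (hAB : ∀ i, A i ⊆ B i)
    (hA : ∀ ⦃i j : ι⦄, i ≠ j → r i ≤ r j → ¬ A i ⊆ B j)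
    (T : Finset (Finset α)) (hT : ∀ ⦃i j : ι⦄, r i ≤ r j → A i \ B j ∈ T) :
    Fintype.card ι ≤ #T := by
  classical
  obtain ⟨μ, hμ⟩ := exists_moebius_weights T
  -- the key identity: for `r i ≤ r j`, `∑_{E ∈ T, E ⊆ A i \ B j} μ E = [i = j]`
  have key : ∀ i j : ι, r i ≤ r j →
      ∑ E ∈ T.filter (· ⊆ A i \ B j), μ E = if i = j then 1 else 0 := by
    intro i j hij
    rw [hμ _ (hT hij)]
    by_cases h : i = j
    · subst h
      simp [sdiff_eq_empty_iff_subset.mpr (hAB i)]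
    · have hne : A i \ B j ≠ ∅ := fun h0 => hA h hij (sdiff_eq_empty_iff_subset.mp h0)
      simp [h, hne]
  -- the two matrices
  let P : Matrix ι T ℚ := fun i E => if (E : Finset α) ⊆ A i then μ E else 0
  let Q : Matrix T ι ℚ := fun E j => if Disjoint (E : Finset α) (B j) then 1 else 0
  have hPQ : ∀ i j, (P * Q) i j = ∑ E ∈ T.filter (· ⊆ A i \ B j), μ E := by
    intro i j
    rw [Matrix.mul_apply]
    have h1 : ∑ E : T, P i E * Q E j =
        ∑ E ∈ T, (if E ⊆ A i then μ E else 0) * (if Disjoint E (B j) then 1 else 0) :=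
      Finset.sum_coe_sort T (fun E => (if E ⊆ A i then μ E else 0) *
        (if Disjoint E (B j) then 1 else 0))
    rw [h1, sum_filter]
    refine sum_congr rfl fun E _ => ?_
    by_cases ha : E ⊆ A i <;> by_cases hb : Disjoint E (B j) <;> simp [ha, hb, subset_sdiff]
  -- `P * Q` is block lower-triangular for `r` with identity diagonal blocks, hence invertible
  have hzero : ∀ i j : ι, i ≠ j → r i ≤ r j → (P * Q) i j = 0 := by
    intro i j hij hr
    rw [hPQ, key i j hr, if_neg hij]
  have hone : ∀ i : ι, (P * Q) i i = 1 := by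
    intro i
    rw [hPQ, key i i le_rfl, if_pos rfl]
  have hBT : (P * Q).BlockTriangular (OrderDual.toDual ∘ r) := by
    intro i j hij
    have hij' : r i < r j := hij
    exact hzero i j (fun h => by subst h; exact lt_irrefl _ hij') hij'.le
  have hdet : (P * Q).det = 1 := by
    rw [hBT.det]
    refine prod_eq_one fun a _ => ?_
    have hblock : (P * Q).toSquareBlock (OrderDual.toDual ∘ r) a = 1 := by
      ext ⟨i, hi⟩ ⟨j, hj⟩
      rw [toSquareBlock_def, of_apply]
      by_cases h : i = j
      · subst h
        rw [hone, one_apply_eq]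
      · have hr : r i = r j := by
          have h1 : OrderDual.toDual (r i) = a := hi
          have h2 : OrderDual.toDual (r j) = a := hj
          exact OrderDual.toDual.injective (h1.trans h2.symm)
        rw [hzero i j h hr.le, one_apply_ne (fun h' => h (Subtype.ext_iff.mp h'))]
    rw [hblock, det_one]
  have hunit : IsUnit (P * Q) := by
    rw [Matrix.isUnit_iff_isUnit_det, hdet]
    exact isUnit_one
  calc Fintype.card ι = (P * Q).rank := (rank_of_isUnit _ hunit).symm
    _ ≤ P.rank := rank_mul_le_left P Q
    _ ≤ Fintype.card T := rank_le_card_width P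
    _ = #T := Fintype.card_coe T

/-- Sequence form: if `A₀, …, A_{m-1}` and targets `Bⱼ ⊇ Aⱼ` satisfy `Aᵢ ⊄ Bⱼ` for `i < j`, then every family `T`
containing the differences `Aᵢ \ Bⱼ` (`i ≤ j`) has at least `m` members. [this work] -/
theorem card_le_card_of_sdiff_target_mem {m : ℕ} (A B : Fin m → Finset α) (hAB : ∀ i, A i ⊆ B i)
    (hA : ∀ ⦃i j : Fin m⦄, i < j → ¬ A i ⊆ B j) (T : Finset (Finset α))
    (hT : ∀ ⦃i j : Fin m⦄, i ≤ j → A i \ B j ∈ T) : m ≤ #T := by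
  have h := card_le_card_of_rank_targets A B id hAB (fun i j hij hle => hA (lt_of_le_of_ne hle hij)) T hT
  rwa [Fintype.card_fin] at h

/-- **Down-closed form.**  If `T` is closed under taking subsets, the membership condition only has to be
checked against a witness: it suffices that each difference `A i \ B j` (`r i ≤ r j`) is contained in SOME member
of `T`.  In particular a column `j` whose target satisfies `(B j)ᶜ ∈ T` inside a ground set needs no membership
check (used with `T` = complements of the goods of a monotone map, memo §4(c)). [this work] -/
theorem card_le_card_of_rank_targets_of_down {ι β : Type*} [Fintype ι] [DecidableEq ι] [LinearOrder β]
    (A B : ι → Finset α) (r : ι → β) (hAB : ∀ i, A i ⊆ B i)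
    (hA : ∀ ⦃i j : ι⦄, i ≠ j → r i ≤ r j → ¬ A i ⊆ B j)
    (T : Finset (Finset α)) (hdown : ∀ ⦃X Y : Finset α⦄, X ∈ T → Y ⊆ X → Y ∈ T)
    (hT : ∀ ⦃i j : ι⦄, r i ≤ r j → ∃ X ∈ T, A i \ B j ⊆ X) :
    Fintype.card ι ≤ #T :=
  card_le_card_of_rank_targets A B r hAB hA T fun i j hij => by
    obtain ⟨X, hX, hsub⟩ := hT hij
    exact hdown hX hsub

end OrderedDifferences

end Summit.CriticalPhenomena.PercolationContinuityZ3.Theorems
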